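import Literature.Probability.Percolation.MarkedLoopTripodCuts
import HarnessLib

/-!
# Boundary span ⟺ boundary non-degeneracy of the tripod-law observables, on every arc («BSPAN-IFF-BNONVANISH»)

Topic `Literature/Probability/Percolation`; generic-`k` layer of the marked-loop (Khristoforov–Smirnov) lineage; a rider on
`MarkedLoopTripodCuts.lean` (for every arc `A_a` of a `k`-marked domain: the compatible patterns `outAt a`, the adapted basis `basisWAt a q` of
the tripod-law solution space `solW k`, uniqueness from any cut `eq_of_mem_solW_of_cutCompat`, and ★★ `obsW_classWt_eq_sum_outAt` — at a
boundary mid-edge `z ∈ A_a` the class-weighted observable of a pattern weight `w` is `Σ_{p ∈ outAt a} w p · N_p(z)`) and on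
`MarkedLoopRotation.lean` / `TriMarkedDomainRotate.lean` (the rotated domain `D.rotate`, `rotate_stretch`, `obsW_rotate_classWt`).

For a number of marks `k` and an arc index `a` two statements about ALL `k`-marked domains are compared:

* `BSpan k a` — **BOUNDARY SPAN**: the boundary pattern-count vectors `(N_p(z))_{p ∈ outAt a}`, `z` ranging over the boundary mid-edges on the
  arc `A_a` of all `k`-marked domains (read at a face with three `H_G`-sides, neither endpoint a corner: `ArcPoint D a`), SPAN `ℂ^{outAt a}`
  (a space of dimension `#NCMatching (k+1)`, `card_outAt_eq_card_ncMatching`);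
* `BNonvanish k a` — **BOUNDARY NON-DEGENERACY**: no non-zero solution `w ∈ solW k` of the tripod law has its class-weighted observable
  `ObsW D (classWt w)` vanishing at every boundary mid-edge of the arc `A_a` of every `k`-marked domain `D`.

Content (every `k`, every arc):
* `ArcPoint D a` (the data of a boundary mid-edge on `A_a`), `ArcPoint.vec` (its count vector on `outAt a`), ★ `ArcPoint.obsW_classWt`
  (`ObsW = Σ_p w p · N_p(z)`, repackaged), `ArcPoint.ofRotate` (a boundary mid-edge on `A_a` of `D.rotate` is one on `A_{a+1}` of `D`);
* (private plumbing) `span_range_eq_top_iff_forall_sum_mul_eq_zero` — finite-dimensional duality on `ι → ℂ`: a family spans iff its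
  dot-product annihilator is trivial (Mathlib's `exists_dual_map_eq_bot_of_lt_top` + `LinearMap.pi_apply_eq_sum_univ`); public face
  `bSpan_iff_forall_sum` (the annihilator form of `BSpan`);
* ★★★ `bSpan_iff_bNonvanish` — **`BSpan k a ⟺ BNonvanish k a`** (the solution space is freely parametrised by the values on `outAt a`:
  `basisWAt`, `eq_of_mem_solW_of_cutCompat`);
* ★★ `bNonvanish_of_succ` / `bNonvanish_iff` / `bSpan_iff` (`k ≥ 2`) — **ARC INDEPENDENCE**: the statements for any two arcs are equivalent
  (rotate the domain: `obsW_rotate_classWt`, `rotate_stretch`, and go round the cycle);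
* ★★ `bSpan_of_triangular` / `bNonvanish_of_triangular` — **THE TRIANGULAR CRITERION**: if every compatible pattern `q` is realised
  (`N_q(z_q) ≠ 0`) at some boundary mid-edge `z_q ∈ A_a` of some domain at which every realised pattern has profile `≤ prof q`, for some
  injective profile `prof : outAt a → P` into a partial order, then `BSpan k a` — the shape of the lane's «skyline» strategy (HOME
  `FINDING-TRIPOD-DOOR-U-TWO-CORNER.md` §4, (T1)–(T3): profile = crossing profile of the link pattern, pointwise order).

Why the lane wants it (HOME `FINDING-TRIPOD-DOOR-U-TWO-CORNER.md` §2, `DESIGN-next-gen21.md` §2): the two-corner face relations of door (U)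
at `k` marks are boundary pattern counts of the `(k−2)`-mark theory, so «the two-corner family kills every consecutive-pair defect» follows
from `BSpan (k−2)`; this file supplies the linear-algebra half `BSpan ⟺ BNonvanish` and the criterion by which `BSpan` is to be proved; the
combinatorial transfer is NOT in this file. The lane's exact numerics: `BSpan` holds arc by arc at `k = 7` on the strip `R(2,7)` (support and
rank `14 = C_4` at all 8 gaps) and at the roomiest arc of `R(2,8)` at `k = 9` (`42 = C_5`) — author-side numerics, not claimed here.

## References
* M. Khristoforov, S. Smirnov, *Percolation and O(1) loop model*, arXiv:2111.15612 (2021), §1.2 (arXiv v1 p. 2: the law of the link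
  pattern), §2 Definition 3 and Lemma 4 with its proof and Fig. 3 (p. 4), eq. (4) and Remark 6 (p. 5: boundary values on the arcs), §3
  (pp. 5–7: the boundary-value problem at `k = 3`).
* B. Bollobás, O. Riordan, *Percolation*, CUP (2006), Ch. 7 §7.2.2 (pp. 191–195: marked discrete domains and their arcs), §7.2.3 p. 197
  (re-marking by relabelling).

## Mathlib / tree
Mathlib: `Submodule.exists_dual_map_eq_bot_of_lt_top`, `LinearMap.pi_apply_eq_sum_univ`, `Submodule.span_induction`, `Finset.exists_minimalFor` (`MinimalFor`), `Finset.sum_coe_sort`,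
`Fin.val_add`, `Nat.mod_add_mod`. Tree: `MarkedLoopTripodCuts` (`outAt`, `mem_outAt`, `CutCompat`, `basisWAt`, `basisWAt_mem_solW`,
`basisWAt_apply_of_cutCompat`, `eq_of_mem_solW_of_cutCompat`, `obsW_classWt_eq_sum_outAt`, `obsW_rotate_classWt`, `comp_patMap_mem_solW`,
`patMap`, `isCyc_rot`), `MarkedLoopTripodBasis` (`Pat`, `solW`, `classWt`, `patternCount`), `MarkedLoopHolomorphy` (`ObsW`),
`TriMarkedDomainRotate` (`rotate`, `rotate_stretch`, `rotate_corners`, `rotate_allSides`), `KhSThreeDisorderObservable` (`AllSides`),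
`MarkedLoopSpace` (`corners`).
-/

open Finset

namespace Literature.Probability.Percolation.MarkedLoops

open Literature.Probability.Percolation Literature.Probability.LatticeModels
open Literature.Probability.Percolation.FivePoint (side tau)
open TriMarkedDomain

/-! ### Linear algebra: a finite family in `ι → ℂ` spans iff its dot-product annihilator is trivial -/

section LinearAlgebra

variable {ι : Type*} [Fintype ι] [DecidableEq ι] {J : Type*}

/-- ★ **finite-dimensional duality**: a family of vectors `f j ∈ ℂ^ι` spans `ℂ^ι` iff every `u ∈ ℂ^ι` with `Σ_i u i · f j i = 0` for all
`j` vanishes (lane plumbing, kept private; the public faces are `bSpan_iff_forall_sum` and `bSpan_iff_bNonvanish`). [folklore] -/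
private theorem span_range_eq_top_iff_forall_sum_mul_eq_zero (f : J → ι → ℂ) :
    Submodule.span ℂ (Set.range f) = ⊤ ↔ ∀ u : ι → ℂ, (∀ j, ∑ i, u i * f j i = 0) → u = 0 := by
  constructor
  · intro hspan u hu
    -- the functional `x ↦ Σ u i x i` kills the family, hence the span, hence everything
    let φ : (ι → ℂ) →ₗ[ℂ] ℂ :=
      { toFun := fun x => ∑ i, u i * x i
        map_add' := fun x y => by
          simp only [Pi.add_apply, mul_add, Finset.sum_add_distrib]
        map_smul' := fun c x => by
          simp only [Pi.smul_apply, smul_eq_mul, RingHom.id_apply, Finset.mul_sum]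
          exact Finset.sum_congr rfl fun i _ => by ring }
    have hφ : ∀ x : ι → ℂ, φ x = 0 := by
      intro x
      have hx : x ∈ Submodule.span ℂ (Set.range f) := by rw [hspan]; exact Submodule.mem_top
      refine Submodule.span_induction ?_ ?_ ?_ ?_ hx
      · rintro _ ⟨j, rfl⟩; exact hu j
      · exact map_zero φ
      · intro x y _ _ hx hy; rw [map_add, hx, hy, add_zero]
      · intro c x _ hx; rw [map_smul, hx, smul_zero]
    funext i
    have h := hφ (Pi.single i 1)
    change ∑ i', u i' * (Pi.single i (1 : ℂ) : ι → ℂ) i' = 0 at h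
    rw [Finset.sum_eq_single i (fun i' _ hi' => by rw [Pi.single_eq_of_ne hi', mul_zero])
      (fun h' => absurd (Finset.mem_univ i) h'), Pi.single_eq_same, mul_one] at h
    exact h
  · intro hann
    by_contra hne
    have hlt : Submodule.span ℂ (Set.range f) < ⊤ := lt_top_iff_ne_top.2 hne
    obtain ⟨φ, hφ0, hφ⟩ := Submodule.exists_dual_map_eq_bot_of_lt_top hlt inferInstance
    -- the coordinates of `φ`
    set u : ι → ℂ := fun i => φ (Pi.single i 1) with hu
    have hφu : ∀ x : ι → ℂ, φ x = ∑ i, u i * x i := by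
      intro x
      rw [LinearMap.pi_apply_eq_sum_univ φ x]
      refine Finset.sum_congr rfl fun i _ => ?_
      rw [smul_eq_mul, mul_comm]
      congr 2
      funext j
      by_cases hij : i = j
      · subst hij; rw [if_pos rfl, Pi.single_eq_same]
      · rw [Pi.single_eq_of_ne (Ne.symm hij), if_neg hij]
    have hfam : ∀ j, ∑ i, u i * f j i = 0 := by
      intro j
      rw [← hφu]
      have : φ (f j) ∈ (Submodule.span ℂ (Set.range f)).map φ := Submodule.mem_map_of_mem (Submodule.subset_span ⟨j, rfl⟩)
      rw [hφ] at this
      exact (Submodule.mem_bot ℂ).1 this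
    have hu0 : u = 0 := hann u hfam
    apply hφ0
    apply LinearMap.ext
    intro x
    rw [hφu x, hu0]
    simp only [Pi.zero_apply, zero_mul, Finset.sum_const_zero, LinearMap.zero_apply]

/-- ★ **the triangular criterion for spanning**: if for a «profile» `h : ι → P` into a partial order, injective, every coordinate `q` has a
member `f (j q)` of the family with `f (j q) q ≠ 0` whose support lies below `q` (`f (j q) p ≠ 0 → h p ≤ h q`), the family spans `ℂ^ι`
(a coordinate of minimal profile in the support of an annihilating `u` is contradictory; lane plumbing, kept private; public face
`bSpan_of_triangular`). [folklore] -/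
private theorem span_range_eq_top_of_triangular (f : J → ι → ℂ) {P : Type*} [PartialOrder P] (h : ι → P)
    (hh : Function.Injective h) (j : ι → J) (hdiag : ∀ q, f (j q) q ≠ 0) (htri : ∀ q p, f (j q) p ≠ 0 → h p ≤ h q) :
    Submodule.span ℂ (Set.range f) = ⊤ := by
  rw [span_range_eq_top_iff_forall_sum_mul_eq_zero]
  intro u hu
  by_contra hne
  -- a coordinate of minimal profile in the support of `u`
  have hsupp : (Finset.univ.filter fun i => u i ≠ 0).Nonempty := by
    by_contra hemp
    rw [Finset.not_nonempty_iff_eq_empty, Finset.filter_eq_empty_iff] at hemp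
    exact hne (funext fun i => not_not.1 (hemp (Finset.mem_univ i)))
  obtain ⟨q, hq, hmin⟩ := Finset.exists_minimalFor h _ hsupp
  have huq : u q ≠ 0 := (Finset.mem_filter.1 hq).2
  have key : ∑ i, u i * f (j q) i = u q * f (j q) q := by
    refine Finset.sum_eq_single q (fun p _ hpq => ?_) (fun h' => absurd (Finset.mem_univ q) h')
    by_cases hup : u p = 0
    · rw [hup, zero_mul]
    · by_cases hfp : f (j q) p = 0
      · rw [hfp, mul_zero]
      · exfalso
        have hle : h p ≤ h q := htri q p hfp
        have hge : h q ≤ h p := hmin (Finset.mem_filter.2 ⟨Finset.mem_univ p, hup⟩) hle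
        exact hpq (hh (le_antisymm hle hge))
  have h0 := hu (j q)
  rw [key] at h0
  exact (mul_ne_zero huq (hdiag q)) h0

end LinearAlgebra

/-! ### Boundary mid-edges on an arc and their count vectors -/

section ArcPoints

variable {nm : ℕ}

/-- **a boundary mid-edge `z` on the arc `A_a`** of a `k`-marked domain, in the lane's reading conventions: the `i`-th side of a face `v`
with three `H_G`-sides, neither endpoint a corner, lying on the boundary dart `(g, o)` of the stretch `A_a`.
[cite: KhristoforovSmirnov2021, §2 eq. (4) and Remark 6 (arXiv v1 p. 5: `z ∈ u_{j−1}u_{j+1}`); BollobasRiordan2006, Ch. 7 §7.2.2 (pp. 191–195: the arcs of a marked domain)] -/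
structure ArcPoint (D : TriMarkedDomain nm) (a : Fin nm) where
  /-- the face at which the mid-edge is read -/
  v : HexVertex
  /-- the side index -/
  i : Fin 3
  /-- the face has three `H_G`-sides -/
  allSides : AllSides D v
  /-- the face is not a corner face -/
  not_corner : v ∉ corners D
  /-- the face across is not a corner face -/
  opp_not_corner : oppFace v i ∉ corners D
  /-- the inner site of the boundary dart -/
  g : Site 2
  /-- the outer site of the boundary dart -/
  o : Site 2
  /-- the side is the bond of the dart -/
  side_eq : side v i = s(g, o)
  /-- the dart lies on the arc `A_a` -/
  mem_stretch : (g, o) ∈ D.stretch a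

namespace ArcPoint

variable {D : TriMarkedDomain nm} {a : Fin nm}

/-- **the count vector** `(N_p(z))_{p ∈ outAt a}` of a boundary mid-edge on `A_a`. [cite: KhristoforovSmirnov2021, §1.2 (arXiv v1 p. 2: the law of the link pattern); §2 eq. (4) (p. 5)] -/
noncomputable def vec (z : ArcPoint D a) : ↥(outAt a) → ℂ := fun p => (patternCount D z.v z.i p.1 : ℂ)

/-- the count vector evaluated. [cite: KhristoforovSmirnov2021, §1.2 (arXiv v1 p. 2)] -/
theorem vec_apply (z : ArcPoint D a) (p : ↥(outAt a)) : z.vec p = (patternCount D z.v z.i p.1 : ℂ) := rfl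

/-- ★ **the class-weighted observable at a boundary mid-edge of `A_a` is the count expansion over the compatible patterns**:
`ObsW D (classWt w) z = Σ_{p ∈ outAt a} w p · N_p(z)` (the tree's `obsW_classWt_eq_sum_outAt`, packaged).
[cite: KhristoforovSmirnov2021, §2 Definition 3 (arXiv v1 p. 4: `F(z) = E[H(ξ)]`); eq. (4) and Remark 6 (p. 5)] -/
theorem obsW_classWt (z : ArcPoint D a) (w : Pat nm → ℂ) :
    ObsW D (classWt w) z.v z.i = ∑ p : ↥(outAt a), w p.1 * z.vec p := by
  rw [obsW_classWt_eq_sum_outAt w z.allSides z.not_corner z.opp_not_corner z.side_eq z.mem_stretch,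
    ← Finset.sum_coe_sort (outAt a)]
  rfl

end ArcPoint

/-- ★ **a boundary mid-edge on the arc `A_a` of the ROTATED domain is a boundary mid-edge on the arc `A_{a+1}` of the domain** (same face,
same side: `rotate_stretch`). [cite: BollobasRiordan2006, Ch. 7 §7.2.3 p. 197 (re-marking by relabelling); KhristoforovSmirnov2021, §1.2 (arXiv v1 p. 2: cyclic indexing)] -/
noncomputable def ArcPoint.ofRotate {n : ℕ} {D : TriMarkedDomain (n + 2)} {a : Fin (n + 2)} (z : ArcPoint D.rotate a) :
    ArcPoint D (a + 1) where
  v := z.v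
  i := z.i
  allSides := (rotate_allSides D z.v).1 z.allSides
  not_corner := by rw [← rotate_corners D]; exact z.not_corner
  opp_not_corner := by rw [← rotate_corners D]; exact z.opp_not_corner
  g := z.g
  o := z.o
  side_eq := z.side_eq
  mem_stretch := by rw [← rotate_stretch D a]; exact z.mem_stretch

end ArcPoints

/-! ### The two statements and their equivalence -/

section Statements

variable (nm : ℕ)

/-- **BOUNDARY SPAN on the arc `A_a`**: the count vectors `(N_p(z))_{p ∈ outAt a}` of the boundary mid-edges `z ∈ A_a` of all `k`-marked
domains span `ℂ^{outAt a}`. [cite: KhristoforovSmirnov2021, §2 eq. (4) and Remark 6 (arXiv v1 p. 5); §3 (pp. 5–7: boundary values at `k = 3`)] -/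
def BSpan (a : Fin nm) : Prop :=
  Submodule.span ℂ (Set.range fun zz : (Σ D : TriMarkedDomain nm, ArcPoint D a) => zz.2.vec) = ⊤

/-- **BOUNDARY NON-DEGENERACY on the arc `A_a`**: a solution of the tripod law whose class-weighted observable vanishes at every boundary
mid-edge of the arc `A_a` of every `k`-marked domain is zero. [cite: KhristoforovSmirnov2021, §2 Definition 3 and Lemma 4 (arXiv v1 p. 4); eq. (4) and Remark 6 (p. 5)] -/
def BNonvanish (a : Fin nm) : Prop :=
  ∀ w : Pat nm → ℂ, w ∈ solW nm → (∀ (D : TriMarkedDomain nm) (z : ArcPoint D a), ObsW D (classWt w) z.v z.i = 0) → w = 0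

variable {nm}

/-- the annihilator form of `BSpan`. [cite: KhristoforovSmirnov2021, §2 eq. (4) and Remark 6 (arXiv v1 p. 5)] -/
theorem bSpan_iff_forall_sum (a : Fin nm) :
    BSpan nm a ↔ ∀ u : ↥(outAt a) → ℂ,
      (∀ (D : TriMarkedDomain nm) (z : ArcPoint D a), ∑ p : ↥(outAt a), u p * z.vec p = 0) → u = 0 := by
  unfold BSpan
  rw [span_range_eq_top_iff_forall_sum_mul_eq_zero]
  constructor
  · intro h u hu
    exact h u fun zz => hu zz.1 zz.2
  · intro h u hu
    exact h u fun D z => hu ⟨D, z⟩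

/-- ★★★ **BOUNDARY SPAN ⟺ BOUNDARY NON-DEGENERACY, on every arc and for every number of marks**: the count vectors of the boundary
mid-edges of `A_a` span `ℂ^{outAt a}` iff no non-zero tripod-law solution has an observable vanishing on `A_a` of every domain — because
the solution space `solW k` is freely and faithfully parametrised by the values on `outAt a` (`basisWAt`, `eq_of_mem_solW_of_cutCompat`) and
the observable at `z ∈ A_a` is the pairing `Σ_{p ∈ outAt a} w p · N_p(z)`.
[cite: KhristoforovSmirnov2021, §2 Definition 3 and Lemma 4 with its proof and Fig. 3 (arXiv v1 p. 4); eq. (4) and Remark 6 (p. 5)] -/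
theorem bSpan_iff_bNonvanish (a : Fin nm) : BSpan nm a ↔ BNonvanish nm a := by
  rw [bSpan_iff_forall_sum]
  constructor
  · intro h w hw hobs
    -- the values of `w` on `outAt a` are annihilated, hence zero; then `w = 0` by uniqueness from the cut
    have hu : (fun p : ↥(outAt a) => w p.1) = 0 := by
      refine h _ fun D z => ?_
      rw [← z.obsW_classWt w]
      exact hobs D z
    refine eq_of_mem_solW_of_cutCompat a hw (Submodule.zero_mem _) fun p hp => ?_
    have := congrFun hu ⟨p, mem_outAt.2 hp⟩
    exact this
  · intro h u hu
    -- the solution with values `u` on `outAt a`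
    set w : Pat nm → ℂ := ∑ q : ↥(outAt a), u q • basisWAt a q.1 with hwdef
    have hw : w ∈ solW nm := Submodule.sum_mem _ fun q _ => Submodule.smul_mem _ _ (basisWAt_mem_solW a q.1)
    have hwval : ∀ p : ↥(outAt a), w p.1 = u p := by
      intro p
      rw [hwdef, Finset.sum_apply, Finset.sum_eq_single p]
      · rw [Pi.smul_apply, smul_eq_mul, basisWAt_apply_of_cutCompat (mem_outAt.1 p.2) (mem_outAt.1 p.2), if_pos rfl, mul_one]
      · intro q _ hqp
        rw [Pi.smul_apply, smul_eq_mul, basisWAt_apply_of_cutCompat (mem_outAt.1 q.2) (mem_outAt.1 p.2),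
          if_neg (fun e => hqp (Subtype.ext e).symm), mul_zero]
      · intro h'; exact absurd (Finset.mem_univ p) h'
    have hw0 : w = 0 := by
      refine h w hw fun D z => ?_
      rw [z.obsW_classWt w]
      simp only [hwval]
      exact hu D z
    funext p
    rw [← hwval p, hw0, Pi.zero_apply, Pi.zero_apply]

end Statements

/-! ### Arc independence (rotate the domain) -/

section ArcIndependence

variable {n : ℕ}

/-- ★ **non-degeneracy on `A_{a+1}` implies non-degeneracy on `A_a`** (`k ≥ 2`): test `w` on the rotated domains — the observable of `w` on
`D.rotate` at a mid-edge of its arc `A_a` is the observable of `w ∘ rot⁻¹` on `D` at a mid-edge of `A_{a+1}` (`obsW_rotate_classWt`,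
`rotate_stretch`). [cite: BollobasRiordan2006, Ch. 7 §7.2.3 p. 197 (re-marking by relabelling); KhristoforovSmirnov2021, §2 Definition 3 (arXiv v1 p. 4), §1.2 (p. 2)] -/
theorem bNonvanish_of_succ {a : Fin (n + 2)} (h : BNonvanish (n + 2) (a + 1)) : BNonvanish (n + 2) a := by
  intro w hw hobs
  set σ := patMap (rot (n + 2)).symm isCyc_rot.symm with hσ
  have hw' : w ∘ σ ∈ solW (n + 2) := comp_patMap_mem_solW _ hw
  have h0 : w ∘ σ = 0 := by
    refine h _ hw' fun D z' => ?_
    -- hmm: we need every mid-edge of `A_{a+1}` of `D` to come from `D.rotate`; instead go the other way: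
    -- `z'` on `A_{a+1}` of `D` IS a mid-edge on `A_a` of `D.rotate`.
    let z : ArcPoint D.rotate a :=
      { v := z'.v, i := z'.i, allSides := (rotate_allSides D z'.v).2 z'.allSides,
        not_corner := by rw [rotate_corners D]; exact z'.not_corner,
        opp_not_corner := by rw [rotate_corners D]; exact z'.opp_not_corner,
        g := z'.g, o := z'.o, side_eq := z'.side_eq,
        mem_stretch := by rw [rotate_stretch D a]; exact z'.mem_stretch }
    have e := hobs D.rotate z
    rw [obsW_rotate_classWt] at e
    exact e
  funext p
  have e := congrFun h0 (σ.symm p)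
  simp only [Function.comp_apply, Equiv.apply_symm_apply, Pi.zero_apply] at e
  exact e

/-- iterating: non-degeneracy on `A_{a+j}` implies non-degeneracy on `A_a`. [cite: BollobasRiordan2006, Ch. 7 §7.2.3 p. 197; KhristoforovSmirnov2021, §1.2 (arXiv v1 p. 2: cyclic indexing)] -/
theorem bNonvanish_of_val_eq (j : ℕ) :
    ∀ a b : Fin (n + 2), b.val = (a.val + j) % (n + 2) → BNonvanish (n + 2) b → BNonvanish (n + 2) a := by
  induction j with
  | zero =>
    intro a b hb h
    have e : b = a := Fin.ext (by rw [hb, Nat.add_zero, Nat.mod_eq_of_lt a.2])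
    rw [← e]
    exact h
  | succ j ih =>
    intro a b hb h
    apply bNonvanish_of_succ
    refine ih (a + 1) b ?_ h
    rw [hb, Fin.val_add, Fin.val_one, Nat.mod_add_mod, show a.val + 1 + j = a.val + (j + 1) by omega]

/-- ★★ **ARC INDEPENDENCE of boundary non-degeneracy** (`k ≥ 2`): `BNonvanish k a ⟺ BNonvanish k b` for any two arcs.
[cite: BollobasRiordan2006, Ch. 7 §7.2.3 p. 197 (re-marking by relabelling); KhristoforovSmirnov2021, §1.2 (arXiv v1 p. 2: cyclic indexing)] -/
theorem bNonvanish_iff (a b : Fin (n + 2)) : BNonvanish (n + 2) a ↔ BNonvanish (n + 2) b := by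
  have key : ∀ a b : Fin (n + 2), BNonvanish (n + 2) b → BNonvanish (n + 2) a := by
    intro a b h
    refine bNonvanish_of_val_eq (b.val + (n + 2) - a.val) a b ?_ h
    have ha := a.2
    rw [show a.val + (b.val + (n + 2) - a.val) = b.val + (n + 2) by omega, Nat.add_mod_right, Nat.mod_eq_of_lt b.2]
  exact ⟨key b a, key a b⟩

/-- ★★ **ARC INDEPENDENCE of boundary span** (`k ≥ 2`): `BSpan k a ⟺ BSpan k b`. [cite: BollobasRiordan2006, Ch. 7 §7.2.3 p. 197; KhristoforovSmirnov2021, §2 eq. (4) and Remark 6 (arXiv v1 p. 5)] -/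
theorem bSpan_iff (a b : Fin (n + 2)) : BSpan (n + 2) a ↔ BSpan (n + 2) b := by
  rw [bSpan_iff_bNonvanish, bSpan_iff_bNonvanish, bNonvanish_iff a b]

end ArcIndependence

/-! ### The triangular criterion -/

section Triangular

variable {nm : ℕ}

/-- ★★ **THE TRIANGULAR CRITERION FOR BOUNDARY SPAN**: suppose there is an injective «profile» of the compatible patterns of the cut at `a`
into a partial order, and for every compatible pattern `q` a `k`-marked domain `D_q` with a boundary mid-edge `z_q ∈ A_a` at which `q` is
realised (`N_q(z_q) ≠ 0`) and every realised pattern has profile below that of `q` (`N_p(z_q) ≠ 0 → prof p ≤ prof q`). Then `BSpan k a`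
(and hence `BNonvanish k a`): in a linear extension the count matrix is triangular with non-zero diagonal. This is the form in which the
lane's «skyline» strategy is to deliver boundary span (profile = the crossing profile of the link pattern, pointwise order).
[cite: KhristoforovSmirnov2021, §2 eq. (4) and Remark 6 (arXiv v1 p. 5); §1.2 (p. 2: the law of the link pattern)] -/
theorem bSpan_of_triangular (a : Fin nm) {P : Type*} [PartialOrder P] (prof : ↥(outAt a) → P) (hprof : Function.Injective prof)
    (Dq : ↥(outAt a) → TriMarkedDomain nm) (zq : ∀ q : ↥(outAt a), ArcPoint (Dq q) a)
    (hdiag : ∀ q : ↥(outAt a), patternCount (Dq q) (zq q).v (zq q).i q.1 ≠ 0)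
    (htri : ∀ q p : ↥(outAt a), patternCount (Dq q) (zq q).v (zq q).i p.1 ≠ 0 → prof p ≤ prof q) : BSpan nm a := by
  unfold BSpan
  refine span_range_eq_top_of_triangular _ prof hprof (fun q => ⟨Dq q, zq q⟩) (fun q => ?_) (fun q p hqp => htri q p ?_)
  · rw [ArcPoint.vec_apply, Nat.cast_ne_zero]
    exact hdiag q
  · rw [ArcPoint.vec_apply, Nat.cast_ne_zero] at hqp
    exact hqp

/-- the same criterion, concluding non-degeneracy. [cite: KhristoforovSmirnov2021, §2 Lemma 4 (arXiv v1 p. 4); eq. (4) and Remark 6 (p. 5)] -/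
theorem bNonvanish_of_triangular (a : Fin nm) {P : Type*} [PartialOrder P] (prof : ↥(outAt a) → P) (hprof : Function.Injective prof)
    (Dq : ↥(outAt a) → TriMarkedDomain nm) (zq : ∀ q : ↥(outAt a), ArcPoint (Dq q) a)
    (hdiag : ∀ q : ↥(outAt a), patternCount (Dq q) (zq q).v (zq q).i q.1 ≠ 0)
    (htri : ∀ q p : ↥(outAt a), patternCount (Dq q) (zq q).v (zq q).i p.1 ≠ 0 → prof p ≤ prof q) : BNonvanish nm a :=
  (bSpan_iff_bNonvanish a).1 (bSpan_of_triangular a prof hprof Dq zq hdiag htri)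

end Triangular

end Literature.Probability.Percolation.MarkedLoops
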